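import Summits.BirchSwinnertonDyer.BirchSwinnertonDyer.Theorems.ResidualThetaTransportAtTwoSignedMuSeedAtTwoPlusTiltLubinTateEngine
import HarnessLib

/-!
# Seed crux `SignedMuSeedAtTwoPlus` (stmt-BirchSwinnertonDyer-21438), line `norm-field-tilt`:
# the ORBIT PRODUCT `Z_m = ∏_{j<2^m} θ([gʲ]t)` doubles — `Z_{m+1} = Z_m · Z_m([g^{2^m}]t)` — and the engine for it

Cell `bsd-wall`, width seat `bsd-wall-rtt-p4-w2` g10; ninth file on the line, on top of p658729 (`…TiltLubinTateEngine`,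
whose hypothesis `hZstep : Z_{m+1} = Z_m·Z_m([h_m]‾t)` is DISCHARGED here from the definition of `Z_m` as an orbit
product).  HONEST FRAMING: THEOREMS ONLY; closes no item; the line is NOT registered; BSD is NOT proved by this.

## What is proved

* `orbitProd_succ` — for any "exponential" family `e : ℕ → k⟦X⟧` (`e_j(0) = 0`, `e_{i+j} = e_i ∘ e_j`, i.e.
  `e (i+j) = (e i).subst (e j)`) and any `θ ∈ k⟦X⟧`: `∏_{j<2^{m+1}} θ(e_j) = Z_m · Z_m(e_{2^m})` with
  `Z_m = ∏_{j<2^m} θ(e_j)` (split the range, `θ(e_{j+2^m}) = θ(e_j)(e_{2^m})`, substitution is multiplicative);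
* `hom_pow_add` — the Lubin–Tate endomorphisms `e_j = [gʲ]` are such a family (`[gⁱ⁺ʲ] = [gⁱ]∘[gʲ]`,
  `LubinTate.hom_comp_hom`), also after reduction modulo `π` (`map_hom_pow_add`); hence
  `orbitProd_hom_succ` : `Z_{m+1} = Z_m · Z_m([g^{2^m}]‾ t)` for `Z_m := ∏_{j<2^m} θ([gʲ]‾ t)` — the card's
  `Z'_{ρ,m+1} = Z'_{ρ,m}·Z'_{ρ,m}([h_m]t̄)`, `h_m = g^{2^m}` (take `θ = θ̄^ρ`);
* **`oddDigit_of_nonDeg_orbit`** — p658729's `oddDigit_of_nonDeg_lubinTate` with `Z_m` GIVEN as the orbit product of a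
  series `θ` and the doubling no longer assumed: hypotheses left are `g^{2^m} = 1 + π^{m+1}·w_m` with `w_m ∉ (π)`
  (the card's «`h_m − 1 ∈ 2^{m+1}ℤ₄^×`»), `Z_m ≠ 0`, `Z_m·S_m = η̄·Z_m'`, `ord Z_m = 2^{m+2}`, the digits
  `Z_m ≡ P_m(s_m) (mod t^{3·4^m})`, and `NonDeg(m₀)`; conclusion `OddDigit(m)` for every `m ≥ m₀ + 2`.

What S1 still owes after this file: `θ = θ̄^ρ` itself (reduced Robert function), `ord Z_m = 2^{m+2}`, the membership,
and the unit statement `g^{2^m} = 1 + π^{m+1} w_m`. [folklore]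
-/

noncomputable section

set_option autoImplicit false
set_option linter.dupNamespace false

open PowerSeries
open Literature.NumberTheory.GaloisRepresentations

namespace Summit.BirchSwinnertonDyer.BirchSwinnertonDyer.Theorems.SignedMuAtTwo.Tilt

/-! ## Orbit products over an exponential family double -/

section Abstract

variable {k : Type*} [CommRing k]

/-- **Doubling of orbit products.**  `e : ℕ → k⟦X⟧` with `e_j(0) = 0` and `e_{i+j} = e_i(e_j)`; then for every `θ`
and `m`: `∏_{j<2^{m+1}} θ(e_j) = (∏_{j<2^m} θ(e_j)) · (∏_{j<2^m} θ(e_j))(e_{2^m})`. [folklore] -/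
theorem orbitProd_succ (e : ℕ → PowerSeries k) (he0 : ∀ j, constantCoeff (e j) = 0)
    (he : ∀ i j, e (i + j) = (e i).subst (e j)) (θ : PowerSeries k) (m : ℕ) :
    ∏ j ∈ Finset.range (2 ^ (m + 1)), (θ.subst (e j) : PowerSeries k) =
      (∏ j ∈ Finset.range (2 ^ m), (θ.subst (e j) : PowerSeries k)) *
        (PowerSeries.subst (e (2 ^ m)) (∏ j ∈ Finset.range (2 ^ m), (θ.subst (e j) : PowerSeries k)) :
          PowerSeries k) := by
  have hs : HasSubst (e (2 ^ m)) := HasSubst.of_constantCoeff_zero' (he0 _)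
  rw [pow_succ, mul_two, Finset.prod_range_add]
  congr 1
  rw [← coe_substAlgHom hs, map_prod]
  refine Finset.prod_congr rfl fun j _ => ?_
  rw [coe_substAlgHom hs, add_comm, he j (2 ^ m),
    subst_comp_subst_apply (HasSubst.of_constantCoeff_zero' (he0 j)) hs]

end Abstract

/-! ## The Lubin–Tate endomorphisms `[gʲ]` form an exponential family (also modulo `π`) -/

variable {A : Type*} [CommRing A] {π : A} {q : ℕ} (hA : LubinTate.IsLTRing π q) {f : PowerSeries A}
  (hf : LubinTate.IsLTSeries π q f)

/-- `[gⁱ⁺ʲ] = [gⁱ]([gʲ])` (`LubinTate.hom_comp_hom`). [folklore] -/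
theorem hom_pow_add (g : A) (i j : ℕ) :
    LubinTate.hom hA hf hf (g ^ (i + j)) = (LubinTate.hom hA hf hf (g ^ i)).subst (LubinTate.hom hA hf hf (g ^ j)) := by
  rw [pow_add, ← LubinTate.hom_comp_hom hA hf hf hf (g ^ i) (g ^ j)]

/-- The same modulo `π`: `[gⁱ⁺ʲ]‾ = [gⁱ]‾([gʲ]‾)`. [folklore] -/
theorem map_hom_pow_add (g : A) (i j : ℕ) :
    (LubinTate.hom hA hf hf (g ^ (i + j))).map (Ideal.Quotient.mk (Ideal.span {π})) =
      ((LubinTate.hom hA hf hf (g ^ i)).map (Ideal.Quotient.mk (Ideal.span {π}))).subst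
        ((LubinTate.hom hA hf hf (g ^ j)).map (Ideal.Quotient.mk (Ideal.span {π}))) := by
  rw [hom_pow_add hA hf g i j,
    map_subst' _ (HasSubst.of_constantCoeff_zero' (LubinTate.constantCoeff_hom hA hf hf _))]

/-- **`Z_{m+1} = Z_m · Z_m([g^{2^m}]‾ t)`** for the reduced orbit product `Z_m = ∏_{j<2^m} θ([gʲ]‾ t)` (any `θ` over
`A/π`; in the line `θ = θ̄^ρ`, `h_m = g^{2^m}`). [folklore] -/
theorem orbitProd_hom_succ (g : A) (θ : PowerSeries (A ⧸ Ideal.span {π})) (m : ℕ) :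
    ∏ j ∈ Finset.range (2 ^ (m + 1)),
        (θ.subst ((LubinTate.hom hA hf hf (g ^ j)).map (Ideal.Quotient.mk (Ideal.span {π}))) :
          PowerSeries (A ⧸ Ideal.span {π})) =
      (∏ j ∈ Finset.range (2 ^ m),
        (θ.subst ((LubinTate.hom hA hf hf (g ^ j)).map (Ideal.Quotient.mk (Ideal.span {π}))) :
          PowerSeries (A ⧸ Ideal.span {π}))) *
      (PowerSeries.subst ((LubinTate.hom hA hf hf (g ^ (2 ^ m))).map (Ideal.Quotient.mk (Ideal.span {π})))
        (∏ j ∈ Finset.range (2 ^ m),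
          (θ.subst ((LubinTate.hom hA hf hf (g ^ j)).map (Ideal.Quotient.mk (Ideal.span {π}))) :
            PowerSeries (A ⧸ Ideal.span {π}))) : PowerSeries (A ⧸ Ideal.span {π})) :=
  orbitProd_succ (fun j => (LubinTate.hom hA hf hf (g ^ j)).map (Ideal.Quotient.mk (Ideal.span {π})))
    (fun j => by rw [constantCoeff_map', LubinTate.constantCoeff_hom, map_zero])
    (fun i j => map_hom_pow_add hA hf g i j) θ m

/-! ## The engine for the orbit product -/

/-- **The tilt engine for the orbit product** (p658729 with the doubling discharged).  Lubin–Tate datum `(A, π, 4, f)`,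
`A/π` a domain, Weierstrass model `U/A` with `U.formalGroupLaw = F_f` and `a₁ ≡ 0 (mod π)`, `g ∈ A` with
`g^{2^m} = 1 + π^{m+1}·w_m`, `w_m ∉ (π)`; `θ ∈ (A/π)⟦t⟧` and `Z_m := ∏_{j<2^m} θ([gʲ]‾ t)`; `S_m` with `Z_m·S_m = η̄·Z_m'`,
`Z_m ≠ 0`, `ord Z_m = 2^{m+2}`, `Z_m ≡ P_m(s_m) (mod t^{3·4^m})`.  Then `ord S_{m₀} = a₀`, `a₀ + 2 < 4^{m₀+1}` ⟹ for
every `m ≥ m₀ + 2` some odd-degree coefficient of `P_m` is non-zero. [folklore] -/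
theorem oddDigit_of_nonDeg_orbit (hA4 : LubinTate.IsLTRing π 4) {f4 : PowerSeries A}
    (hf4 : LubinTate.IsLTSeries π 4 f4) [IsDomain (A ⧸ Ideal.span {π})]
    (U : WeierstrassCurve A) (hU : U.formalGroupLaw = LubinTate.ltF hA4 hf4)
    (ha₁ : (U.map (Ideal.Quotient.mk (Ideal.span {π}))).a₁ = 0)
    (g : A) (w : ℕ → A) (hg : ∀ m, g ^ (2 ^ m) = 1 + π ^ (m + 1) * w m) (hw : ∀ m, w m ∉ Ideal.span {π})
    (θ : PowerSeries (A ⧸ Ideal.span {π}))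
    (S s : ℕ → PowerSeries (A ⧸ Ideal.span {π})) (P : ℕ → Polynomial (A ⧸ Ideal.span {π}))
    (hZ : ∀ m, ∏ j ∈ Finset.range (2 ^ m),
        (θ.subst ((LubinTate.hom hA4 hf4 hf4 (g ^ j)).map (Ideal.Quotient.mk (Ideal.span {π}))) :
          PowerSeries (A ⧸ Ideal.span {π})) ≠ 0)
    (hZS : ∀ m, (∏ j ∈ Finset.range (2 ^ m),
        (θ.subst ((LubinTate.hom hA4 hf4 hf4 (g ^ j)).map (Ideal.Quotient.mk (Ideal.span {π}))) :
          PowerSeries (A ⧸ Ideal.span {π}))) * S m =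
      (U.map (Ideal.Quotient.mk (Ideal.span {π}))).formalEta *
        d⁄dX (A ⧸ Ideal.span {π}) (∏ j ∈ Finset.range (2 ^ m),
          (θ.subst ((LubinTate.hom hA4 hf4 hf4 (g ^ j)).map (Ideal.Quotient.mk (Ideal.span {π}))) :
            PowerSeries (A ⧸ Ideal.span {π}))))
    (hZord : ∀ m, PowerSeries.order (∏ j ∈ Finset.range (2 ^ m),
        (θ.subst ((LubinTate.hom hA4 hf4 hf4 (g ^ j)).map (Ideal.Quotient.mk (Ideal.span {π}))) :
          PowerSeries (A ⧸ Ideal.span {π}))) = (2 ^ (m + 2) : ℕ))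
    (hmem : ∀ m, (X : PowerSeries (A ⧸ Ideal.span {π})) ^ (3 * 4 ^ m) ∣
      (∏ j ∈ Finset.range (2 ^ m),
        (θ.subst ((LubinTate.hom hA4 hf4 hf4 (g ^ j)).map (Ideal.Quotient.mk (Ideal.span {π}))) :
          PowerSeries (A ⧸ Ideal.span {π}))) - Polynomial.aeval (s m) (P m))
    {m₀ a₀ : ℕ} (ha₀ : (S m₀).order = a₀) (hnd : a₀ + 2 < 4 ^ (m₀ + 1))
    {m : ℕ} (hm : m₀ + 2 ≤ m) : ∃ i, Odd i ∧ (P m).coeff i ≠ 0 :=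
  oddDigit_of_nonDeg_lubinTate hA4 hf4 U hU ha₁ w hw
    (fun m => ∏ j ∈ Finset.range (2 ^ m),
      (θ.subst ((LubinTate.hom hA4 hf4 hf4 (g ^ j)).map (Ideal.Quotient.mk (Ideal.span {π}))) :
        PowerSeries (A ⧸ Ideal.span {π})))
    S s P hZ hZS (fun m => by rw [← hg m]; exact orbitProd_hom_succ hA4 hf4 g θ m) hZord hmem ha₀ hnd hm

end Summit.BirchSwinnertonDyer.BirchSwinnertonDyer.Theorems.SignedMuAtTwo.Tilt

end
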